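import Literature.Barriers.CriticalPhenomena.PlanarEdwardsModelDiffusiveSILTMoments
import Mathlib.Analysis.SpecialFunctions.Integrals.Basic
import Mathlib.Analysis.SpecialFunctions.Pow.Continuity
import Mathlib.Analysis.MeanInequalities
import HarnessLib

/-!
# Mollified self-intersection local time of planar Brownian motion: the uniform bound on the
# covariance density (Varadhan's second-moment computation, step 2)

Sibling file of `Literature.Barriers.CriticalPhenomena.PlanarEdwardsModelDiffusive`, continuing
`PlanarEdwardsModelDiffusiveSILTMoments` towards `Edwards2D.Varadhan1969_l2Convergence`. There,
`Cov(T_k, T_l) = ∫_{[0,1]⁴} Φ_{k,l}` (`Edwards2D.covariance_mollifiedSILT`) with the explicit density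
`Φ_{k,l} = Edwards2D.covDensity k l`. Writing `a = |t-s|`, `b = |v-u|`, `ℓ = |c|`
(`c = incrCov s t u v`, the signed overlap of the two time intervals), `A = a + 1/k`,
`B = b + 1/l`, one has `(2π)² Φ_{k,l} = ℓ²/(AB(AB - ℓ²))` (`covDensity_eq`). This file proves:

* the interval algebra of the overlap: `|c| ≤ a ∧ b` (`abs_incrCov_le_left/right`), and, when the
  intervals overlap (`ℓ > 0`), `a + b - 2ℓ = |s∧t - u∧v| + |s∨t - u∨v|` (`symmDiff_eq_of_incrCov_pos`);
* `Φ_{k,l} ≥ 0`, `Φ_{k,l} ≤ kl/(2π)²`, and **monotonicity** `Φ_{k,l} ≤ Φ_{k',l'}` for `k ≤ k'`,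
  `l ≤ l'` (`covDensity_mono`);
* the **pointwise bound** (`covDensity_le_dominant`): for `k, l ≥ 1`,
  `Φ_{k,l} ≤ (1/8π²) (a + 1/k)^{-1/2} (|s∧t - u∧v| + 1/k)^{-3/4} (|s∨t - u∨v| + 1/l)^{-3/4}`
  (from `AB - ℓ² ≥ ℓ(A + B - 2ℓ)`, `AB ≥ ℓ (A ∨ B)`, `A ∨ B ≥ (2A + Δ)/4` and the AM–GM inequality
  `(2A + p + q)(p + q) ≥ 8 √A (pq)^{3/4}`);
* the one-dimensional integral `∫₀¹ (|x - c| + ε)^r dx ≤ 4/(r+1)` for `-1 < r ≤ 0`, `0 < ε ≤ 1`,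
  `c ∈ [0,1]` (`integral_abs_sub_add_rpow_le`, Mathlib's `integral_rpow`), and hence the
  **uniform bound** `∫_{[0,1]⁴} Φ_{k,l} ≤ 52` for all `k, l` (`integral_covDensity_le`).

No probability enters this file.

## References

* S. R. S. Varadhan, Appendix to K. Symanzik, *Euclidean quantum field theory* (1969) (the
  second-moment method; not consulted). The elementary estimates here are ours. [folklore]
-/

noncomputable section

open MeasureTheory Real Filter Set Function
open scoped NNReal ENNReal Topology

namespace Literature.Barriers.CriticalPhenomena

namespace Edwards2D

open Literature.Probability.Process

/-! ### Interval algebra of the overlap `incrCov` -/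

/-- For ordered pairs `s ≤ t`, `u ≤ v`, `incrCov s t u v = (t ∧ v - s ∨ u)⁺`, the length of the
overlap of `[s,t]` and `[u,v]`. [folklore] -/
theorem incrCov_eq_of_le {s t u v : ℝ} (hst : s ≤ t) (huv : u ≤ v) :
    incrCov s t u v = max 0 (min t v - max s u) := by
  unfold incrCov
  rcases le_or_gt t u with h1 | h1
  · -- `[s,t]` lies to the left of `[u,v]`
    rw [min_eq_left (h1.trans huv), min_eq_left h1, min_eq_left (hst.trans (h1.trans huv)),
      min_eq_left (hst.trans h1), max_eq_right (hst.trans h1), max_eq_left (by linarith)]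
    ring
  rcases le_or_gt v s with h2 | h2
  · -- `[u,v]` lies to the left of `[s,t]`
    rw [min_eq_right (h2.trans hst), min_eq_right (huv.trans (h2.trans hst)), min_eq_right h2,
      min_eq_right (huv.trans h2), max_eq_left (huv.trans h2), max_eq_left (by linarith)]
    ring
  · -- overlapping
    rw [min_eq_right h1.le, min_eq_left h2.le]
    have h3 : max s u ≤ min t v := max_le (le_min hst h2.le) (le_min h1.le huv)
    rw [max_eq_right (by linarith)]
    linarith [min_add_max s u]

/-- For ordered pairs the overlap is nonnegative. [folklore] -/
theorem incrCov_nonneg_of_le {s t u v : ℝ} (hst : s ≤ t) (huv : u ≤ v) : 0 ≤ incrCov s t u v := by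
  rw [incrCov_eq_of_le hst huv]
  exact le_max_left _ _

/-- For ordered pairs the overlap is at most the length of the first interval. [folklore] -/
theorem incrCov_le_left_of_le {s t u v : ℝ} (hst : s ≤ t) (huv : u ≤ v) : incrCov s t u v ≤ t - s := by
  rw [incrCov_eq_of_le hst huv]
  refine max_le (by linarith) ?_
  linarith [min_le_left t v, le_max_left s u]

/-- For ordered pairs the overlap is at most the length of the second interval. [folklore] -/
theorem incrCov_le_right_of_le {s t u v : ℝ} (hst : s ≤ t) (huv : u ≤ v) : incrCov s t u v ≤ v - u := by
  rw [incrCov_eq_of_le hst huv]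
  refine max_le (by linarith) ?_
  linarith [min_le_right t v, le_max_right s u]

/-- **`|c| ≤ |t - s|`**: the overlap is at most the length of the first interval. [folklore] -/
theorem abs_incrCov_le_left (s t u v : ℝ) : |incrCov s t u v| ≤ |t - s| := by
  rcases le_total s t with hst | hst <;> rcases le_total u v with huv | huv
  · rw [abs_of_nonneg (incrCov_nonneg_of_le hst huv), abs_of_nonneg (by linarith)]
    exact incrCov_le_left_of_le hst huv
  · rw [← neg_neg (incrCov s t u v), ← incrCov_swap_right, abs_neg,
      abs_of_nonneg (incrCov_nonneg_of_le hst huv), abs_of_nonneg (by linarith)]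
    exact incrCov_le_left_of_le hst huv
  · rw [← neg_neg (incrCov s t u v), ← incrCov_swap_left, abs_neg,
      abs_of_nonneg (incrCov_nonneg_of_le hst huv), abs_sub_comm, abs_of_nonneg (by linarith)]
    exact incrCov_le_left_of_le hst huv
  · rw [show incrCov s t u v = incrCov t s v u by rw [incrCov_swap_left, incrCov_swap_right, neg_neg],
      abs_of_nonneg (incrCov_nonneg_of_le hst huv), abs_sub_comm, abs_of_nonneg (by linarith)]
    exact incrCov_le_left_of_le hst huv

/-- **`|c| ≤ |v - u|`**: the overlap is at most the length of the second interval. [folklore] -/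
theorem abs_incrCov_le_right (s t u v : ℝ) : |incrCov s t u v| ≤ |v - u| := by
  rw [← incrCov_comm]
  exact abs_incrCov_le_left u v s t

/-- For ordered overlapping pairs, `(t - s) + (v - u) - 2c = |s - u| + |t - v|` (the measure of the
symmetric difference of the two intervals). [folklore] -/
theorem symmDiff_eq_of_le {s t u v : ℝ} (hst : s ≤ t) (huv : u ≤ v) (hpos : 0 < incrCov s t u v) :
    (t - s) + (v - u) - 2 * incrCov s t u v = |s - u| + |t - v| := by
  rw [incrCov_eq_of_le hst huv] at hpos ⊢
  have hlt : 0 < min t v - max s u := by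
    by_contra h
    rw [max_eq_left (not_lt.1 h)] at hpos
    exact lt_irrefl 0 hpos
  rw [max_eq_right hlt.le]
  rcases le_total t v with h1 | h1 <;> rcases le_total s u with h2 | h2
  · rw [min_eq_left h1, max_eq_right h2, abs_of_nonpos (by linarith), abs_of_nonpos (by linarith)]
    ring
  · rw [min_eq_left h1, max_eq_left h2, abs_of_nonneg (by linarith), abs_of_nonpos (by linarith)]
    ring
  · rw [min_eq_right h1, max_eq_right h2, abs_of_nonpos (by linarith), abs_of_nonneg (by linarith)]
    ring
  · rw [min_eq_right h1, max_eq_left h2, abs_of_nonneg (by linarith), abs_of_nonneg (by linarith)]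
    ring

/-- **Symmetric difference in general position**: if the overlap `ℓ = |incrCov s t u v|` is
positive then `|t - s| + |v - u| - 2ℓ = |s∧t - u∧v| + |s∨t - u∨v|`. [folklore] -/
theorem symmDiff_eq_of_incrCov_pos {s t u v : ℝ} (hpos : 0 < |incrCov s t u v|) :
    |t - s| + |v - u| - 2 * |incrCov s t u v| = |min s t - min u v| + |max s t - max u v| := by
  rcases le_total s t with hst | hst <;> rcases le_total u v with huv | huv
  · rw [abs_of_nonneg (incrCov_nonneg_of_le hst huv)] at hpos ⊢
    rw [min_eq_left hst, min_eq_left huv, max_eq_right hst, max_eq_right huv,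
      abs_of_nonneg (sub_nonneg.2 hst), abs_of_nonneg (sub_nonneg.2 huv)]
    exact symmDiff_eq_of_le hst huv hpos
  · have h : incrCov s t u v = -incrCov s t v u := by rw [incrCov_swap_right]
    rw [h, abs_neg, abs_of_nonneg (incrCov_nonneg_of_le hst huv)] at hpos ⊢
    rw [min_eq_left hst, min_eq_right huv, max_eq_right hst, max_eq_left huv,
      abs_of_nonneg (sub_nonneg.2 hst), abs_sub_comm v u, abs_of_nonneg (sub_nonneg.2 huv)]
    exact symmDiff_eq_of_le hst huv hpos
  · have h : incrCov s t u v = -incrCov t s u v := by rw [incrCov_swap_left]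
    rw [h, abs_neg, abs_of_nonneg (incrCov_nonneg_of_le hst huv)] at hpos ⊢
    rw [min_eq_right hst, min_eq_left huv, max_eq_left hst, max_eq_right huv,
      abs_sub_comm t s, abs_of_nonneg (sub_nonneg.2 hst), abs_of_nonneg (sub_nonneg.2 huv)]
    exact symmDiff_eq_of_le hst huv hpos
  · have h : incrCov s t u v = incrCov t s v u := by
      rw [incrCov_swap_left, incrCov_swap_right, neg_neg]
    rw [h, abs_of_nonneg (incrCov_nonneg_of_le hst huv)] at hpos ⊢
    rw [min_eq_right hst, min_eq_right huv, max_eq_left hst, max_eq_left huv,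
      abs_sub_comm t s, abs_of_nonneg (sub_nonneg.2 hst), abs_sub_comm v u,
      abs_of_nonneg (sub_nonneg.2 huv)]
    exact symmDiff_eq_of_le hst huv hpos

/-! ### The two elementary inequalities -/

/-- **The algebraic core of the pointwise bound.** For `0 ≤ ℓ ≤ a ∧ b`, `A = a + ε`, `B = b + ε'`
(`ε, ε' > 0`) and `Δ ≥ 0` with `a + b - 2ℓ = Δ` whenever `ℓ > 0`:
`ℓ²/(AB(AB - ℓ²)) ≤ 4/((2A + Δ')Δ')`, `Δ' = Δ + ε + ε'` — via `AB - ℓ² = (A-ℓ)(B-ℓ) + ℓΔ' ≥ ℓΔ'`,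
`AB ≥ ℓ(A ∨ B)` and `A ∨ B ≥ max(A, Δ'/2) ≥ (2A + Δ')/4`. [folklore] -/
theorem core_bound {a b ℓ Δ ε ε' : ℝ} (ha : ℓ ≤ a) (hb : ℓ ≤ b) (hℓ : 0 ≤ ℓ) (hΔ : 0 ≤ Δ)
    (hε : 0 < ε) (hε' : 0 < ε') (hsd : 0 < ℓ → a + b - 2 * ℓ = Δ) :
    ℓ ^ 2 / ((a + ε) * (b + ε') * ((a + ε) * (b + ε') - ℓ ^ 2)) ≤
      4 / ((2 * (a + ε) + (Δ + ε + ε')) * (Δ + ε + ε')) := by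
  have hA : ℓ < a + ε := by linarith
  have hB : ℓ < b + ε' := by linarith
  have hApos : 0 < a + ε := by linarith
  have hBpos : 0 < b + ε' := by linarith
  have hΔ' : 0 < Δ + ε + ε' := by linarith
  have hRHS : 0 < 4 / ((2 * (a + ε) + (Δ + ε + ε')) * (Δ + ε + ε')) := by positivity
  rcases hℓ.eq_or_lt with h0 | hℓpos
  · -- no overlap: the density vanishes
    rw [← h0]
    simp only [ne_eq, OfNat.ofNat_ne_zero, not_false_eq_true, zero_pow, zero_div]
    exact hRHS.le
  have hsd' : (a + ε) + (b + ε') - 2 * ℓ = Δ + ε + ε' := by linarith [hsd hℓpos]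
  -- `AB - ℓ² ≥ ℓ Δ'`
  have h1 : ℓ * (Δ + ε + ε') ≤ (a + ε) * (b + ε') - ℓ ^ 2 := by
    rw [← hsd']
    nlinarith [mul_pos (sub_pos.2 hA) (sub_pos.2 hB)]
  have h1pos : 0 < (a + ε) * (b + ε') - ℓ ^ 2 := lt_of_lt_of_le (by positivity) h1
  -- `AB ≥ ℓ (A ∨ B)` and `A ∨ B ≥ (2A + Δ')/4`
  have h2 : ℓ * ((2 * (a + ε) + (Δ + ε + ε')) / 4) ≤ (a + ε) * (b + ε') := by
    have hM1 : ℓ * (a + ε) ≤ (a + ε) * (b + ε') := by nlinarith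
    have hM2 : ℓ * (b + ε') ≤ (a + ε) * (b + ε') := by nlinarith
    have hmax : (2 * (a + ε) + (Δ + ε + ε')) / 4 ≤ max (a + ε) (b + ε') := by
      have : (Δ + ε + ε') / 2 ≤ max (a + ε) (b + ε') := by
        rw [← hsd']
        linarith [le_max_left (a + ε) (b + ε'), le_max_right (a + ε) (b + ε')]
      linarith [le_max_left (a + ε) (b + ε')]
    calc ℓ * ((2 * (a + ε) + (Δ + ε + ε')) / 4) ≤ ℓ * max (a + ε) (b + ε') :=
          mul_le_mul_of_nonneg_left hmax hℓ
      _ ≤ (a + ε) * (b + ε') := by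
          rcases le_total (a + ε) (b + ε') with h | h
          · rwa [max_eq_right h]
          · rwa [max_eq_left h]
  -- combine
  rw [div_le_div_iff₀ (by positivity) (by positivity)]
  have h3 : ℓ ^ 2 * ((2 * (a + ε) + (Δ + ε + ε')) * (Δ + ε + ε')) =
      4 * ((ℓ * ((2 * (a + ε) + (Δ + ε + ε')) / 4)) * (ℓ * (Δ + ε + ε'))) := by ring
  rw [h3]
  exact mul_le_mul_of_nonneg_left (mul_le_mul h2 h1 (by positivity) (by positivity)) (by norm_num)

/-- **AM–GM step**: for `A, p, q > 0`, `8 √A (pq)^{3/4} ≤ (2A + p + q)(p + q)`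
(`p + q ≥ 2u²` and `A + u² ≥ 2√A u` with `u = (pq)^{1/4}`). [folklore] -/
theorem amgm_bound {A p q : ℝ} (hA : 0 < A) (hp : 0 < p) (hq : 0 < q) :
    8 * √A * (p * q) ^ (3 / 4 : ℝ) ≤ (2 * A + p + q) * (p + q) := by
  set w : ℝ := (p * q) ^ (1 / 4 : ℝ) with hw
  have hpq : 0 < p * q := mul_pos hp hq
  have hwpos : 0 < w := Real.rpow_pos_of_pos hpq _
  have hw2 : w ^ 2 = √(p * q) := by
    rw [hw, ← Real.rpow_natCast, ← Real.rpow_mul hpq.le, Real.sqrt_eq_rpow]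
    norm_num
  have hw3 : (p * q) ^ (3 / 4 : ℝ) = w ^ 3 := by
    rw [hw, ← Real.rpow_natCast, ← Real.rpow_mul hpq.le]
    norm_num
  have hw4 : w ^ 2 * w ^ 2 = p * q := by
    rw [hw2, Real.mul_self_sqrt hpq.le]
  -- `p + q ≥ 2 w²`
  have h1 : 2 * w ^ 2 ≤ p + q := by
    nlinarith [sq_nonneg (√p - √q), Real.mul_self_sqrt hp.le, Real.mul_self_sqrt hq.le,
      Real.sqrt_mul_self hp.le, hw2, Real.sqrt_mul hp.le q]
  -- `A + w² ≥ 2 √A w`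
  have h2 : 2 * √A * w ≤ A + w ^ 2 := by
    nlinarith [sq_nonneg (√A - w), Real.mul_self_sqrt hA.le]
  rw [hw3]
  have hsA : 0 ≤ √A := Real.sqrt_nonneg A
  calc 8 * √A * w ^ 3 = 4 * w ^ 2 * (2 * √A * w) := by ring
    _ ≤ 4 * w ^ 2 * (A + w ^ 2) := mul_le_mul_of_nonneg_left h2 (by positivity)
    _ = (2 * A + 2 * w ^ 2) * (2 * w ^ 2) := by ring
    _ ≤ (2 * A + (p + q)) * (p + q) :=
        mul_le_mul (by linarith) h1 (by positivity) (by positivity)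
    _ = (2 * A + p + q) * (p + q) := by ring

/-- The AM–GM step in the form used: `4/((2A + p + q)(p + q)) ≤ (1/2) A^{-1/2} p^{-3/4} q^{-3/4}`.
[folklore] -/
theorem inv_bound {A p q : ℝ} (hA : 0 < A) (hp : 0 < p) (hq : 0 < q) :
    4 / ((2 * A + p + q) * (p + q)) ≤
      1 / 2 * (A ^ (-(1 / 2) : ℝ) * (p ^ (-(3 / 4) : ℝ) * q ^ (-(3 / 4) : ℝ))) := by
  have h := amgm_bound hA hp hq
  have hpos : 0 < 8 * √A * (p * q) ^ (3 / 4 : ℝ) := by positivity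
  rw [Real.rpow_neg hA.le, Real.rpow_neg hp.le, Real.rpow_neg hq.le, ← Real.sqrt_eq_rpow,
    ← mul_inv, ← Real.mul_rpow hp.le hq.le]
  rw [div_le_iff₀ (by positivity)]
  calc (4 : ℝ) = 1 / 2 * ((√A)⁻¹ * ((p * q) ^ (3 / 4 : ℝ))⁻¹) * (8 * √A * (p * q) ^ (3 / 4 : ℝ)) := by
        field_simp
        ring
    _ ≤ 1 / 2 * ((√A)⁻¹ * ((p * q) ^ (3 / 4 : ℝ))⁻¹) * ((2 * A + p + q) * (p + q)) :=
        mul_le_mul_of_nonneg_left h (by positivity)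

/-! ### The one-dimensional integral -/

/-- **`∫₀¹ (|x - c| + ε)^r dx ≤ 4/(r+1)`** for `-1 < r ≤ 0`, `0 < ε ≤ 1`, `c ∈ [0,1]` (split at
`c`, translate, Mathlib's `integral_rpow`; each half is `((L+ε)^{r+1} - ε^{r+1})/(r+1) ≤ 2/(r+1)`).
[folklore] -/
theorem integral_abs_sub_add_rpow_le {r ε c : ℝ} (hr : -1 < r) (hr0 : r ≤ 0) (hε : 0 < ε)
    (hε1 : ε ≤ 1) (hc0 : 0 ≤ c) (hc1 : c ≤ 1) :
    ∫ x in Icc (0 : ℝ) 1, (|x - c| + ε) ^ r ≤ 4 / (r + 1) := by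
  have hr1 : 0 < r + 1 := by linarith
  have hcont : Continuous fun x : ℝ => (|x - c| + ε) ^ r :=
    Continuous.rpow_const (by fun_prop) fun x => Or.inl (by positivity)
  rw [integral_Icc_eq_integral_Ioc, ← intervalIntegral.integral_of_le zero_le_one,
    ← intervalIntegral.integral_add_adjacent_intervals (b := c) (hcont.intervalIntegrable _ _)
      (hcont.intervalIntegrable _ _)]
  -- left half
  have hL : ∫ x in (0 : ℝ)..c, (|x - c| + ε) ^ r = ((c + ε) ^ (r + 1) - ε ^ (r + 1)) / (r + 1) := by
    have heq : EqOn (fun x : ℝ => (|x - c| + ε) ^ r) (fun x => (c + ε - x) ^ r) (uIcc 0 c) := by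
      intro x hx
      rw [uIcc_of_le hc0, mem_Icc] at hx
      simp only
      rw [abs_of_nonpos (by linarith)]
      ring_nf
    rw [intervalIntegral.integral_congr heq,
      intervalIntegral.integral_comp_sub_left (fun x : ℝ => x ^ r) (c + ε)]
    simp only [add_sub_cancel_left]
    rw [integral_rpow (Or.inl hr)]
    ring_nf
  -- right half
  have hR : ∫ x in c..(1 : ℝ), (|x - c| + ε) ^ r = ((1 - c + ε) ^ (r + 1) - ε ^ (r + 1)) / (r + 1) := by
    have heq : EqOn (fun x : ℝ => (|x - c| + ε) ^ r) (fun x => (x + (ε - c)) ^ r) (uIcc c 1) := by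
      intro x hx
      rw [uIcc_of_le hc1, mem_Icc] at hx
      simp only
      rw [abs_of_nonneg (by linarith)]
      ring_nf
    rw [intervalIntegral.integral_congr heq,
      intervalIntegral.integral_comp_add_right (fun x : ℝ => x ^ r) (ε - c)]
    rw [show c + (ε - c) = ε by ring, show (1 : ℝ) + (ε - c) = 1 - c + ε by ring,
      integral_rpow (Or.inl hr)]
  rw [hL, hR]
  -- bounds `y^{r+1} ≤ 2` for `0 ≤ y ≤ 2`
  have hpow : ∀ y : ℝ, 0 ≤ y → y ≤ 2 → y ^ (r + 1) ≤ 2 := by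
    intro y hy0 hy2
    calc y ^ (r + 1) ≤ (2 : ℝ) ^ (r + 1) := Real.rpow_le_rpow hy0 hy2 hr1.le
      _ ≤ (2 : ℝ) ^ (1 : ℝ) := Real.rpow_le_rpow_of_exponent_le (by norm_num) (by linarith)
      _ = 2 := Real.rpow_one 2
  have hε' : 0 ≤ ε ^ (r + 1) := Real.rpow_nonneg hε.le _
  have hA := hpow (c + ε) (by positivity) (by linarith)
  have hB := hpow (1 - c + ε) (by linarith) (by linarith)
  rw [← add_div, div_le_div_iff_of_pos_right hr1]
  linarith

/-- The one-dimensional bound with the time clamped to `ℝ≥0` (as in `Edwards2D.covDensity`; on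
`[0,1]` the clamp is the identity) and either orientation of the difference. [folklore] -/
theorem integral_abs_clamp_sub_add_rpow_le {r ε c : ℝ} (hr : -1 < r) (hr0 : r ≤ 0) (hε : 0 < ε)
    (hε1 : ε ≤ 1) (hc0 : 0 ≤ c) (hc1 : c ≤ 1) :
    ∫ x in Icc (0 : ℝ) 1, (|((x.toNNReal : ℝ≥0) : ℝ) - c| + ε) ^ r ≤ 4 / (r + 1) ∧
    ∫ x in Icc (0 : ℝ) 1, (|c - ((x.toNNReal : ℝ≥0) : ℝ)| + ε) ^ r ≤ 4 / (r + 1) := by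
  have h1 : ∫ x in Icc (0 : ℝ) 1, (|((x.toNNReal : ℝ≥0) : ℝ) - c| + ε) ^ r =
      ∫ x in Icc (0 : ℝ) 1, (|x - c| + ε) ^ r := by
    refine setIntegral_congr_fun measurableSet_Icc fun x hx => ?_
    simp only [Real.coe_toNNReal _ hx.1]
  have h2 : ∫ x in Icc (0 : ℝ) 1, (|c - ((x.toNNReal : ℝ≥0) : ℝ)| + ε) ^ r =
      ∫ x in Icc (0 : ℝ) 1, (|x - c| + ε) ^ r := by
    refine setIntegral_congr_fun measurableSet_Icc fun x hx => ?_
    simp only [Real.coe_toNNReal _ hx.1, abs_sub_comm c x]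
  rw [h1, h2]
  exact ⟨integral_abs_sub_add_rpow_le hr hr0 hε hε1 hc0 hc1,
    integral_abs_sub_add_rpow_le hr hr0 hε hε1 hc0 hc1⟩

/-! ### The covariance density: closed form, sign, monotonicity, pointwise bound -/

/-- `c² ≤ |t-s| |v-u|` (the overlap is at most either length). [folklore] -/
theorem sq_incrCov_le (s t u v : ℝ) : incrCov s t u v ^ 2 ≤ |t - s| * |v - u| := by
  rw [← sq_abs]
  rw [sq]
  exact mul_le_mul (abs_incrCov_le_left s t u v) (abs_incrCov_le_right s t u v) (abs_nonneg _)
    (abs_nonneg _)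

/-- The discriminant is at least one: `1 ≤ (1 + k a)(1 + l b) - kl c²` for `k, l ≥ 0`. [folklore] -/
theorem one_le_discr {k l : ℝ} (hk : 0 ≤ k) (hl : 0 ≤ l) (s t u v : ℝ) :
    1 ≤ (1 + k * |t - s|) * (1 + l * |v - u|) - k * l * incrCov s t u v ^ 2 := by
  have h := sq_incrCov_le s t u v
  have h1 : 0 ≤ k * |t - s| := by positivity
  have h2 : 0 ≤ l * |v - u| := by positivity
  nlinarith [mul_nonneg (mul_nonneg hk hl) (sub_nonneg.2 h)]

section Density

variable (k l : ℕ) (pq : (ℝ × ℝ) × (ℝ × ℝ))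

/-- Shorthand-free restatement of `Edwards2D.covDensity` with named clamped times. [folklore] -/
theorem covDensity_def :
    covDensity k l pq =
      (k : ℝ) / (2 * π) * (l / (2 * π)) *
        (1 / ((1 + k * |((pq.1.2.toNNReal : ℝ≥0) : ℝ) - pq.1.1.toNNReal|) *
              (1 + l * |((pq.2.2.toNNReal : ℝ≥0) : ℝ) - pq.2.1.toNNReal|) -
            k * l * incrCov pq.1.1.toNNReal pq.1.2.toNNReal pq.2.1.toNNReal pq.2.2.toNNReal ^ 2) -
          1 / ((1 + k * |((pq.1.2.toNNReal : ℝ≥0) : ℝ) - pq.1.1.toNNReal|) *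
            (1 + l * |((pq.2.2.toNNReal : ℝ≥0) : ℝ) - pq.2.1.toNNReal|))) := rfl

/-- **`Φ_{k,l} ≥ 0`** (`D ≤ (1+ka)(1+lb)` and `D ≥ 1`). [folklore] -/
theorem covDensity_nonneg : 0 ≤ covDensity k l pq := by
  rw [covDensity_def]
  set a := |((pq.1.2.toNNReal : ℝ≥0) : ℝ) - pq.1.1.toNNReal|
  set b := |((pq.2.2.toNNReal : ℝ≥0) : ℝ) - pq.2.1.toNNReal|
  set c := incrCov pq.1.1.toNNReal pq.1.2.toNNReal pq.2.1.toNNReal pq.2.2.toNNReal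
  have hD : 1 ≤ (1 + k * a) * (1 + l * b) - k * l * c ^ 2 :=
    one_le_discr (Nat.cast_nonneg k) (Nat.cast_nonneg l) _ _ _ _
  have hE : (1 + k * a) * (1 + l * b) - k * l * c ^ 2 ≤ (1 + k * a) * (1 + l * b) := by
    have : 0 ≤ (k : ℝ) * l * c ^ 2 := by positivity
    linarith
  refine mul_nonneg (by positivity) (sub_nonneg.2 ?_)
  exact one_div_le_one_div_of_le (by linarith) hE

/-- **`Φ_{k,l} ≤ kl/(2π)²`** (`1/D ≤ 1`). [folklore] -/
theorem covDensity_le : covDensity k l pq ≤ k / (2 * π) * (l / (2 * π)) := by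
  rw [covDensity_def]
  set a := |((pq.1.2.toNNReal : ℝ≥0) : ℝ) - pq.1.1.toNNReal|
  set b := |((pq.2.2.toNNReal : ℝ≥0) : ℝ) - pq.2.1.toNNReal|
  set c := incrCov pq.1.1.toNNReal pq.1.2.toNNReal pq.2.1.toNNReal pq.2.2.toNNReal
  have hD : 1 ≤ (1 + k * a) * (1 + l * b) - k * l * c ^ 2 :=
    one_le_discr (Nat.cast_nonneg k) (Nat.cast_nonneg l) _ _ _ _
  have h1 : 1 / ((1 + k * a) * (1 + l * b) - k * l * c ^ 2) ≤ 1 := by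
    rw [div_le_one (by linarith)]
    exact hD
  have h2 : 0 ≤ 1 / ((1 + k * a) * (1 + l * b)) := by positivity
  calc (k : ℝ) / (2 * π) * (l / (2 * π)) *
        (1 / ((1 + k * a) * (1 + l * b) - k * l * c ^ 2) - 1 / ((1 + k * a) * (1 + l * b)))
      ≤ (k : ℝ) / (2 * π) * (l / (2 * π)) * 1 :=
        mul_le_mul_of_nonneg_left (by linarith) (by positivity)
    _ = _ := mul_one _

/-- `|Φ_{k,l}| ≤ kl/(2π)²`. [folklore] -/
theorem norm_covDensity_le : ‖covDensity k l pq‖ ≤ k / (2 * π) * (l / (2 * π)) := by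
  rw [Real.norm_eq_abs, abs_of_nonneg (covDensity_nonneg k l pq)]
  exact covDensity_le k l pq

/-- **Closed form** for `k, l ≥ 1`: `Φ_{k,l} = (1/(2π)²) c²/(AB(AB - c²))`, `A = a + 1/k`,
`B = b + 1/l` (from `(1 + ka)(1 + lb) = kl AB`). [folklore] -/
theorem covDensity_eq (hk : 1 ≤ k) (hl : 1 ≤ l) :
    covDensity k l pq = 1 / (2 * π) ^ 2 *
      (incrCov pq.1.1.toNNReal pq.1.2.toNNReal pq.2.1.toNNReal pq.2.2.toNNReal ^ 2 /
        ((|((pq.1.2.toNNReal : ℝ≥0) : ℝ) - pq.1.1.toNNReal| + 1 / k) *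
            (|((pq.2.2.toNNReal : ℝ≥0) : ℝ) - pq.2.1.toNNReal| + 1 / l) *
          ((|((pq.1.2.toNNReal : ℝ≥0) : ℝ) - pq.1.1.toNNReal| + 1 / k) *
              (|((pq.2.2.toNNReal : ℝ≥0) : ℝ) - pq.2.1.toNNReal| + 1 / l) -
            incrCov pq.1.1.toNNReal pq.1.2.toNNReal pq.2.1.toNNReal pq.2.2.toNNReal ^ 2))) := by
  rw [covDensity_def]
  set a := |((pq.1.2.toNNReal : ℝ≥0) : ℝ) - pq.1.1.toNNReal|
  set b := |((pq.2.2.toNNReal : ℝ≥0) : ℝ) - pq.2.1.toNNReal|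
  set c := incrCov pq.1.1.toNNReal pq.1.2.toNNReal pq.2.1.toNNReal pq.2.2.toNNReal
  have hk0 : (0 : ℝ) < k := by exact_mod_cast hk
  have hl0 : (0 : ℝ) < l := by exact_mod_cast hl
  have hD : 1 ≤ (1 + k * a) * (1 + l * b) - k * l * c ^ 2 :=
    one_le_discr (Nat.cast_nonneg k) (Nat.cast_nonneg l) _ _ _ _
  have ha : 0 ≤ a := abs_nonneg _
  have hb : 0 ≤ b := abs_nonneg _
  have hE : 0 < (1 + k * a) * (1 + l * b) := by positivity
  have hAB : (a + 1 / k) * (b + 1 / l) - c ^ 2 = ((1 + k * a) * (1 + l * b) - k * l * c ^ 2) / (k * l) := by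
    field_simp
    ring
  have hAB' : (a + 1 / k) * (b + 1 / l) = ((1 + k * a) * (1 + l * b)) / (k * l) := by
    field_simp
    ring
  rw [hAB, hAB']
  have hD0 : (1 + k * a) * (1 + l * b) - k * l * c ^ 2 ≠ 0 := by linarith
  field_simp
  ring

/-- **Monotonicity `Φ_{k,l} ≤ Φ_{k',l'}` for `k ≤ k'`, `l ≤ l'`** (`c²/(AB(AB - c²))` decreases in
`A` and `B`). [folklore] -/
theorem covDensity_mono {k k' l l' : ℕ} (hk : k ≤ k') (hl : l ≤ l') (pq : (ℝ × ℝ) × (ℝ × ℝ)) :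
    covDensity k l pq ≤ covDensity k' l' pq := by
  rcases Nat.eq_zero_or_pos k with hk0 | hk0
  · subst hk0
    have : covDensity 0 l pq = 0 := by rw [covDensity_def]; simp
    rw [this]
    exact covDensity_nonneg _ _ _
  rcases Nat.eq_zero_or_pos l with hl0 | hl0
  · subst hl0
    have : covDensity k 0 pq = 0 := by rw [covDensity_def]; simp
    rw [this]
    exact covDensity_nonneg _ _ _
  have hk' : 1 ≤ k' := le_trans hk0 hk
  have hl' : 1 ≤ l' := le_trans hl0 hl
  rw [covDensity_eq k l pq hk0 hl0, covDensity_eq k' l' pq hk' hl']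
  set a := |((pq.1.2.toNNReal : ℝ≥0) : ℝ) - pq.1.1.toNNReal|
  set b := |((pq.2.2.toNNReal : ℝ≥0) : ℝ) - pq.2.1.toNNReal|
  set c := incrCov pq.1.1.toNNReal pq.1.2.toNNReal pq.2.1.toNNReal pq.2.2.toNNReal
  have hca : |c| ≤ a := abs_incrCov_le_left _ _ _ _
  have hcb : |c| ≤ b := abs_incrCov_le_right _ _ _ _
  have hc0 : 0 ≤ |c| := abs_nonneg c
  have hkk : (1 : ℝ) / k' ≤ 1 / k := one_div_le_one_div_of_le (by exact_mod_cast hk0) (by exact_mod_cast hk)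
  have hll : (1 : ℝ) / l' ≤ 1 / l := one_div_le_one_div_of_le (by exact_mod_cast hl0) (by exact_mod_cast hl)
  have hk'0 : (0 : ℝ) < 1 / k' := by positivity
  have hl'0 : (0 : ℝ) < 1 / l' := by positivity
  have hA' : |c| < a + 1 / k' := by linarith
  have hB' : |c| < b + 1 / l' := by linarith
  have hc2 : c ^ 2 = |c| ^ 2 := (sq_abs c).symm
  -- the smaller denominator is positive
  have hprod' : c ^ 2 < (a + 1 / k') * (b + 1 / l') := by
    rw [hc2, sq]
    exact mul_lt_mul'' hA' hB' hc0 hc0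
  have hden' : 0 < (a + 1 / k') * (b + 1 / l') * ((a + 1 / k') * (b + 1 / l') - c ^ 2) :=
    mul_pos (by positivity) (sub_pos.2 hprod')
  refine mul_le_mul_of_nonneg_left ?_ (by positivity)
  refine div_le_div_of_nonneg_left (sq_nonneg c) hden' ?_
  have hmono : (a + 1 / k') * (b + 1 / l') ≤ (a + 1 / k) * (b + 1 / l) :=
    mul_le_mul (by linarith) (by linarith) (by positivity) (by positivity)
  exact mul_le_mul hmono (by linarith) (sub_pos.2 hprod').le (by positivity)

/-- **The pointwise bound**: for `k, l ≥ 1`,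
`Φ_{k,l} ≤ (1/8π²) (a + 1/k)^{-1/2} (|s∧t - u∧v| + 1/k)^{-3/4} (|s∨t - u∨v| + 1/l)^{-3/4}` (clamped
times). [folklore] -/
theorem covDensity_le_dominant (hk : 1 ≤ k) (hl : 1 ≤ l) :
    covDensity k l pq ≤ 1 / (8 * π ^ 2) *
      ((|((pq.1.2.toNNReal : ℝ≥0) : ℝ) - pq.1.1.toNNReal| + 1 / k) ^ (-(1 / 2) : ℝ) *
        ((|min ((pq.1.1.toNNReal : ℝ≥0) : ℝ) pq.1.2.toNNReal -
              min ((pq.2.1.toNNReal : ℝ≥0) : ℝ) pq.2.2.toNNReal| + 1 / k) ^ (-(3 / 4) : ℝ) *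
          (|max ((pq.1.1.toNNReal : ℝ≥0) : ℝ) pq.1.2.toNNReal -
              max ((pq.2.1.toNNReal : ℝ≥0) : ℝ) pq.2.2.toNNReal| + 1 / l) ^ (-(3 / 4) : ℝ))) := by
  rw [covDensity_eq k l pq hk hl]
  set s := ((pq.1.1.toNNReal : ℝ≥0) : ℝ)
  set t := ((pq.1.2.toNNReal : ℝ≥0) : ℝ)
  set u := ((pq.2.1.toNNReal : ℝ≥0) : ℝ)
  set v := ((pq.2.2.toNNReal : ℝ≥0) : ℝ)
  set c := incrCov s t u v
  have hk0 : (0 : ℝ) < 1 / k := by positivity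
  have hl0 : (0 : ℝ) < 1 / l := by positivity
  -- step 1: the algebraic core
  have hcore := core_bound (a := |t - s|) (b := |v - u|) (ℓ := |c|)
    (Δ := |min s t - min u v| + |max s t - max u v|) (ε := 1 / k) (ε' := 1 / l)
    (abs_incrCov_le_left s t u v) (abs_incrCov_le_right s t u v) (abs_nonneg c) (by positivity)
    hk0 hl0 (fun hpos => symmDiff_eq_of_incrCov_pos hpos)
  rw [sq_abs] at hcore
  -- step 2: AM–GM
  have hinv := inv_bound (A := |t - s| + 1 / k) (p := |min s t - min u v| + 1 / k)
    (q := |max s t - max u v| + 1 / l) (by positivity) (by positivity) (by positivity)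
  have h12 : c ^ 2 / ((|t - s| + 1 / k) * (|v - u| + 1 / l) *
      ((|t - s| + 1 / k) * (|v - u| + 1 / l) - c ^ 2)) ≤
      1 / 2 * ((|t - s| + 1 / k) ^ (-(1 / 2) : ℝ) *
        ((|min s t - min u v| + 1 / k) ^ (-(3 / 4) : ℝ) * (|max s t - max u v| + 1 / l) ^ (-(3 / 4) : ℝ))) := by
    refine hcore.trans (le_trans (le_of_eq ?_) hinv)
    ring_nf
  calc 1 / (2 * π) ^ 2 * (c ^ 2 / ((|t - s| + 1 / k) * (|v - u| + 1 / l) *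
        ((|t - s| + 1 / k) * (|v - u| + 1 / l) - c ^ 2)))
      ≤ 1 / (2 * π) ^ 2 * (1 / 2 * ((|t - s| + 1 / k) ^ (-(1 / 2) : ℝ) *
        ((|min s t - min u v| + 1 / k) ^ (-(3 / 4) : ℝ) * (|max s t - max u v| + 1 / l) ^ (-(3 / 4) : ℝ)))) :=
        mul_le_mul_of_nonneg_left h12 (by positivity)
    _ = _ := by ring

end Density

end Edwards2D

end Literature.Barriers.CriticalPhenomena
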